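import Literature.Computability.Complexity.SkeletonTableauSound
import HarnessLib

/-!
# The quasi-linear tableau of a flat stack program, III: completeness

Literature / circuit complexity (serves `williams_acc` through the leaf
`Williams2014_fact_3_1_skeleton`; see `SkeletonTableau.lean`). This file proves the
COMPLETENESS of the local constraints `TabOK`: if the program, started at address `0` with
`boolPair x y` (`|x| = n`, `|y| ≤ Y`) on its input register, reaches the halting address with
output register `[true]` within `T` steps, then some assignment satisfies `TabOK` and spells
`x` on the input-copy variables (`Tableau.tabOK_complete`). The assignment is the intended one: the
genuine transcript, the true heights with their carry chains, the records of the genuine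
events, the permutation networks switched (Beneš–Waksman, `PermutationNetworks.lean`) so as to
SORT the records by key — which is possible because a genuine transcript is consistent and
hence has a sorted certificate (`StackEventConsistency.lean`) — and the comparison chains
evaluated.
-/

namespace Literature.Computability.Complexity

namespace Tableau

open StackEvents FlatRun Benes

/-! ### Networks read backwards -/

/-- Reading a network backwards: the input position whose content reaches position `p` after
the first `ℓ` layers (dimensions `dm`, settings `s`). [folklore] -/
def back (dm : ℕ → ℕ) (s : ℕ → ℕ → Bool) : ℕ → ℕ → ℕ
  | 0, p => p
  | ℓ + 1, p => back dm s ℓ (layer (dm ℓ) (s ℓ) p)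

/-- `back` is `run` over the reversed layer list. [folklore] -/
theorem back_eq_run (dm : ℕ → ℕ) (s : ℕ → ℕ → Bool) : ∀ (ℓ p : ℕ),
    back dm s ℓ p = run ((List.range ℓ).reverse.map dm) (fun i => s (ℓ - 1 - i)) p
  | 0, _ => rfl
  | ℓ + 1, p => by
    show back dm s ℓ (layer (dm ℓ) (s ℓ) p) = _
    rw [back_eq_run dm s ℓ, List.range_succ, List.reverse_append, List.reverse_singleton,
      List.singleton_append, List.map_cons, run_cons]
    simp only [Nat.add_sub_cancel, Nat.sub_zero]
    congr 1
    funext i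
    congr 1
    omega

/-- The Beneš dimension list is a palindrome. [folklore] -/
theorem reverse_dims : ∀ k, (dims k).reverse = dims k
  | 0 => rfl
  | k + 1 => by
    show (0 :: ((dims k).map (· + 1) ++ [0])).reverse = 0 :: ((dims k).map (· + 1) ++ [0])
    rw [List.reverse_cons, List.reverse_append, List.reverse_singleton, List.map_reverse .. |>.symm,
      reverse_dims k]
    simp

/-- The layer dimensions of a tableau, listed, are `dims k`. [folklore] -/
theorem map_dim_range (tb : TabParams) : (List.range tb.L).map tb.dim = dims tb.k := by
  apply List.ext_getElem
  · simp [TabParams.L]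
  · intro i h1 h2
    simp only [List.getElem_map, List.getElem_range, TabParams.dim]
    rw [List.getD_eq_getElem _ _ h2]

/-- **Reading all `2k` layers backwards is the Beneš network run forwards** on the reversed
settings. [folklore] -/
theorem back_L (tb : TabParams) (s : ℕ → ℕ → Bool) (p : ℕ) :
    back tb.dim s tb.L p = run (dims tb.k) (fun i => s (tb.L - 1 - i)) p := by
  rw [back_eq_run, List.map_reverse, map_dim_range, reverse_dims]

/-- `posBack` is `back`. [folklore] -/
theorem posBack_eq_back {tb : TabParams} (τ : TabVar tb.K → Bool) (κ : Fin tb.K) :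
    ∀ ℓ p, posBack tb τ κ ℓ p = back tb.dim (fun ℓ => swf tb τ κ ℓ) ℓ p
  | 0, _ => rfl
  | ℓ + 1, _ => posBack_eq_back τ κ ℓ _

/-! ### Records of an event family -/

/-- High type bit of an event. [folklore] -/
def t1E : Ev → Bool
  | .popNone => true
  | .popSome _ => true
  | _ => false

/-- Low type bit of an event. [folklore] -/
def t0E : Ev → Bool
  | .push _ => true
  | .popSome _ => true
  | _ => false

/-- Symbol bit of an event. [folklore] -/
def symE : Ev → Bool
  | .push b => b
  | .popSome b => b
  | _ => false

/-- The time-`0` record of time `s` of an event family with levels `lev`, bit `w`.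
[folklore] -/
def rec0 (k : ℕ) (ev : ℕ → Ev) (lev : ℕ → ℕ) (s w : ℕ) : Bool :=
  if w = 0 then t1E (ev s) else if w = 1 then t0E (ev s) else if w = 2 then symE (ev s)
  else if w ≤ 3 + k then ThreeCNF.bit (w - 3) (lev s) else ThreeCNF.bit (w - (k + 4)) s

/-- The carry/borrow chain of an increment (`push`) or decrement (`popSome`) of the bit
vector `a`. [folklore] -/
def hcVal (a : ℕ → Bool) (e : Ev) : ℕ → Bool
  | 0 => true
  | j + 1 => (match e with | .push _ => a j | .popSome _ => !a j | _ => false) && hcVal a e j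

/-- The comparison chain of two bit vectors. [folklore] -/
def ltVal (a b : ℕ → Bool) : ℕ → Bool
  | 0 => false
  | i + 1 => if a i = b i then ltVal a b i else b i

/-- The equality chain of two bit vectors. [folklore] -/
def aeVal (a b : ℕ → Bool) : ℕ → Bool
  | 0 => true
  | j + 1 => aeVal a b j && (a j == b j)

/-- Equal bit vectors pass the equality chain. [folklore] -/
theorem aeVal_of_eq {a b : ℕ → Bool} : ∀ {m}, (∀ j < m, a j = b j) → aeVal a b m = true
  | 0, _ => rfl
  | m + 1, h => by
    show (aeVal a b m && (a m == b m)) = true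
    rw [aeVal_of_eq (fun j hj => h j (Nat.lt_succ_of_lt hj)), h m (Nat.lt_succ_self m)]; simp

/-- The true height never exceeds the time. [folklore] -/
theorem ht_le (ev : ℕ → Ev) : ∀ s, ht ev s ≤ s
  | 0 => le_rfl
  | s + 1 => by
    have := ht_le ev s
    show (st ev (s + 1)).length ≤ s + 1
    rw [length_st_succ]
    revert this; unfold ht
    cases ev s <;> simp <;> omega

/-! ### The genuine timeline -/

section Complete

variable (tb : TabParams) (x y : List Bool)

/-- The genuine configuration at machine time `s ≥ I`. [folklore] -/
def C (s : ℕ) : ACfg Bool (Fin tb.K) :=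
  (tb.P.step^[s - tb.I]) ⟨0, AStore.single tb.inp (boolPair x y)⟩

/-- **The genuine event timeline** of register `κ`: the scheduled virtual pushes, the register
events of the genuine run, the final pop of `out`, idle steps. [folklore] -/
def evG (κ : Fin tb.K) (s : ℕ) : Ev :=
  if s < tb.Y then
    (if κ = tb.inp ∧ tb.Y - 1 - s < y.length then .push (y.getD (tb.Y - 1 - s) false) else .nop)
  else if s < tb.I then
    (if κ = tb.inp then .push (Sum.elim id (fun j => x.getD j false) (v2src tb.n (s - tb.Y)))
     else .nop)
  else if s < tb.Send then regEv tb.P κ (C tb x y s).pc (popped tb.P (C tb x y s))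
  else if s = tb.Send then (if κ = tb.out then .popSome true else .nop)
  else .nop

variable {tb x y}

/-- The genuine timeline follows the virtual-phase schedule. [folklore] -/
theorem virtualPhase_evG : VirtualPhase (evG tb x y) (fun j => decide (j < y.length))
    (fun j => y.getD j false) (fun j => x.getD j false) := by
  refine ⟨fun s hs => ?_, fun r hr => ?_, fun κ hκ s hs => ?_⟩
  · simp only [evG, if_pos hs, true_and]
    by_cases h : tb.Y - 1 - s < y.length <;> simp [h]
  · have h1 : ¬ tb.Y + r < tb.Y := by omega
    have h2 : tb.Y + r < tb.I := by unfold TabParams.I; omega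
    simp only [evG, h1, if_false, h2, if_true, Nat.add_sub_cancel_left]
  · unfold evG
    by_cases h1 : s < tb.Y
    · rw [if_pos h1, if_neg (fun h => hκ h.1)]
    · rw [if_neg h1, if_pos hs, if_neg hκ]

/-- The genuine run step by step. [folklore] -/
theorem C_succ {s : ℕ} (hs : tb.I ≤ s) : C tb x y (s + 1) = tb.P.step (C tb x y s) := by
  unfold C
  rw [show s + 1 - tb.I = (s - tb.I) + 1 by omega, Function.iterate_succ_apply']

/-- `C_I` (auxiliary). [folklore] -/
theorem C_I : C tb x y tb.I = ⟨0, AStore.single tb.inp (boolPair x y)⟩ := by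
  simp [C]

/-- The replayed genuine timeline is the genuine register content through the machine phase.
[folklore] -/
theorem st_evG (hy : y.length ≤ tb.Y) (hxn : x.length = tb.n) :
    ∀ s, tb.I ≤ s → s ≤ tb.Send → ∀ κ, st (evG tb x y κ) s = (C tb x y s).regs κ := by
  intro s hIs hsS
  obtain ⟨d, rfl⟩ := Nat.exists_eq_add_of_le hIs
  induction d with
  | zero =>
    intro κ
    have h := congr_fun ((virtualPhase_evG (tb := tb) (x := x) (y := y)).st_I hxn (fun j _ => rfl)) κ
    rw [ysOf_prefix tb hy] at h
    rw [Nat.add_zero, C_I]; exact h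
  | succ d ih =>
    intro κ
    have hle : tb.I + d ≤ tb.Send := by omega
    have hlt : tb.I + d < tb.Send := by omega
    rw [Nat.add_succ, C_succ (Nat.le_add_right _ _)]
    show upd (evG tb x y κ (tb.I + d)) (st (evG tb x y κ) (tb.I + d)) = _
    rw [ih (Nat.le_add_right _ _) hle κ]
    have hev : evG tb x y κ (tb.I + d) = regEv tb.P κ (C tb x y (tb.I + d)).pc (popped tb.P (C tb x y (tb.I + d))) := by
      unfold evG
      have hYI : tb.Y ≤ tb.I := Nat.le_add_right _ _
      rw [if_neg (by omega), if_neg (by omega), if_pos hlt]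
    rw [hev]
    exact ((transcript_of_step tb.P (C tb x y (tb.I + d))).2.1 κ).symm

variable (hxn : x.length = tb.n) (hy : y.length ≤ tb.Y) {t : ℕ} (ht0 : t ≤ tb.T)
  (hrun : (tb.P.step^[t]) ⟨0, AStore.single tb.inp (boolPair x y)⟩ = ⟨tb.np, AStore.single tb.out [true]⟩)

include hrun in
/-- From the halting time on the configuration is the final one. [folklore] -/
theorem C_of_ge {s : ℕ} (hs : tb.I + t ≤ s) : C tb x y s = ⟨tb.np, AStore.single tb.out [true]⟩ := by
  unfold C
  rw [show s - tb.I = (s - tb.I - t) + t by omega, Function.iterate_add_apply, hrun]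
  exact tb.P.iterate_step_of_le le_rfl _

include hrun ht0 in
/-- `C_Send` (auxiliary). [folklore] -/
theorem C_Send : C tb x y tb.Send = ⟨tb.np, AStore.single tb.out [true]⟩ :=
  C_of_ge hrun (by unfold TabParams.Send; omega)

include hrun ht0 in
/-- All visited addresses are genuine addresses `≤ |P|`. [folklore] -/
theorem pc_C_le {s : ℕ} (h1 : tb.I ≤ s) (h2 : s ≤ tb.Send) : (C tb x y s).pc ≤ tb.np := by
  by_contra hgt
  have hge : tb.np ≤ (C tb x y s).pc := (Nat.lt_of_not_le hgt).le
  have hfix : C tb x y tb.Send = C tb x y s := by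
    unfold C
    rw [show tb.Send - tb.I = (tb.Send - s) + (s - tb.I) by omega, Function.iterate_add_apply]
    exact tb.P.iterate_step_of_le hge _
  rw [C_Send ht0 hrun] at hfix
  exact hgt (by rw [← hfix])

include hxn hy hrun ht0 in
/-- **The genuine timeline is consistent.** [folklore] -/
theorem consistent_evG (κ : Fin tb.K) : Consistent (evG tb x y κ) tb.S := by
  have hYI : tb.Y ≤ tb.I := Nat.le_add_right _ _
  have hIS : tb.I ≤ tb.Send := Nat.le_add_right _ _
  intro s hs
  by_cases h1 : s < tb.I
  · -- virtual phase: no pops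
    have hnp : ∀ b, evG tb x y κ s ≠ .popNone ∧ evG tb x y κ s ≠ .popSome b := by
      intro b; unfold evG
      by_cases h0 : s < tb.Y
      · rw [if_pos h0]; split_ifs <;> exact ⟨by simp, by simp⟩
      · rw [if_neg h0, if_pos h1]; split_ifs <;> exact ⟨by simp, by simp⟩
    exact ⟨fun h => absurd h (hnp true).1, fun b h => absurd h (hnp b).2⟩
  by_cases h2 : s < tb.Send
  · have hIs : tb.I ≤ s := Nat.le_of_not_lt h1
    have hst := st_evG hy hxn s hIs h2.le κ
    have hev : evG tb x y κ s = regEv tb.P κ (C tb x y s).pc (popped tb.P (C tb x y s)) := by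
      unfold evG; rw [if_neg (by omega), if_neg h1, if_pos h2]
    obtain ⟨-, -, hnone, hsome⟩ := transcript_of_step tb.P (C tb x y s)
    rw [hst, hev]
    exact ⟨hnone κ, hsome κ⟩
  by_cases h3 : s = tb.Send
  · subst h3
    have hst := st_evG hy hxn tb.Send (Nat.le_add_right _ _) le_rfl κ
    rw [C_Send ht0 hrun] at hst
    have hev : evG tb x y κ tb.Send = (if κ = tb.out then .popSome true else .nop) := by
      unfold evG; rw [if_neg (by omega), if_neg h1, if_neg h2, if_pos rfl]
    rw [hev, hst]
    by_cases hκ : κ = tb.out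
    · subst hκ; simp
    · simp [hκ]
  · have hev : evG tb x y κ s = .nop := by
      unfold evG; rw [if_neg (by omega), if_neg h1, if_neg h2, if_neg h3]
    rw [hev]; exact ⟨fun h => Ev.noConfusion h, fun b h => Ev.noConfusion h⟩

end Complete

/-! ### Bits of heights: the carry chains of the true increments and decrements -/

/-- Bits of `H + 1` from the bits of `H` through the increment chain; no overflow. [folklore] -/
theorem inc_bits {H m : ℕ} (hH : H + 1 < 2 ^ m) (b : Bool) :
    (∀ j < m, ThreeCNF.bit j (H + 1) =
      (ThreeCNF.bit j H ^^ hcVal (fun j => ThreeCNF.bit j H) (.push b) j)) ∧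
    hcVal (fun j => ThreeCNF.bit j H) (.push b) m = false := by
  set a : ℕ → Bool := fun j => ThreeCNF.bit j H with ha
  set c : ℕ → Bool := hcVal a (.push b) with hc
  have key := inc_chain (a := a) (a' := fun j => a j ^^ c j) (c := c) rfl m (fun j _ => ⟨rfl, rfl⟩)
  have hba : bval a m = H := by rw [ha, bval_bit, Nat.mod_eq_of_lt (by omega)]
  rw [hba] at key
  have hlt := bval_lt (fun j => a j ^^ c j) m
  have hcm : c m = false := by
    cases hcm : c m
    · rfl
    · rw [hcm, if_pos rfl] at key; omega
  rw [hcm] at key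
  simp only [Bool.false_eq_true, if_false, Nat.add_zero] at key
  refine ⟨fun j hj => ?_, hcm⟩
  have hb1 : bval (fun j => ThreeCNF.bit j (H + 1)) m = bval (fun j => a j ^^ c j) m := by
    rw [bval_bit, Nat.mod_eq_of_lt hH, key]
  exact bits_eq_of_bval_eq hb1 j hj

/-- Bits of `H - 1` from the bits of `H ≥ 1` through the decrement chain; no underflow.
[folklore] -/
theorem dec_bits {H m : ℕ} (hH : H < 2 ^ m) (h1 : 1 ≤ H) (b : Bool) :
    (∀ j < m, ThreeCNF.bit j (H - 1) =
      (ThreeCNF.bit j H ^^ hcVal (fun j => ThreeCNF.bit j H) (.popSome b) j)) ∧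
    hcVal (fun j => ThreeCNF.bit j H) (.popSome b) m = false := by
  set a : ℕ → Bool := fun j => ThreeCNF.bit j H with ha
  set c : ℕ → Bool := hcVal a (.popSome b) with hc
  have key := dec_chain (a := a) (a' := fun j => a j ^^ c j) (b := c) rfl m (fun j _ => ⟨rfl, rfl⟩)
  have hba : bval a m = H := by rw [ha, bval_bit, Nat.mod_eq_of_lt hH]
  rw [hba] at key
  have hlt := bval_lt (fun j => a j ^^ c j) m
  have hcm : c m = false := by
    cases hcm : c m
    · rfl
    · rw [hcm, if_pos rfl] at key; omega
  rw [hcm] at key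
  simp only [Bool.false_eq_true, if_false, Nat.add_zero] at key
  refine ⟨fun j hj => ?_, hcm⟩
  have hb1 : bval (fun j => ThreeCNF.bit j (H - 1)) m = bval (fun j => a j ^^ c j) m := by
    rw [bval_bit, Nat.mod_eq_of_lt (by omega)]; omega
  exact bits_eq_of_bval_eq hb1 j hj

/-- `bit j 0 = false`. [folklore] -/
theorem bit_zero (j : ℕ) : ThreeCNF.bit j 0 = false := by simp [ThreeCNF.bit]

/-! ### Fields of the records -/

section Rec

variable (k : ℕ) (ev : ℕ → Ev) (lev : ℕ → ℕ) (s : ℕ)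

/-- `rec0_fT1` (auxiliary). [folklore] -/
theorem rec0_fT1 : rec0 k ev lev s fT1 = t1E (ev s) := by simp [rec0, fT1]
/-- `rec0_fT0` (auxiliary). [folklore] -/
theorem rec0_fT0 : rec0 k ev lev s fT0 = t0E (ev s) := by simp [rec0, fT0]
/-- `rec0_fSym` (auxiliary). [folklore] -/
theorem rec0_fSym : rec0 k ev lev s fSym = symE (ev s) := by simp [rec0, fSym]
/-- `rec0_fLev` (auxiliary). [folklore] -/
theorem rec0_fLev {j : ℕ} (hj : j ≤ k) : rec0 k ev lev s (fLev j) = ThreeCNF.bit j (lev s) := by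
  simp only [rec0, fLev, show 3 + j ≠ 0 by omega, show 3 + j ≠ 1 by omega, show 3 + j ≠ 2 by omega,
    if_false, show 3 + j ≤ 3 + k by omega, if_true, Nat.add_sub_cancel_left]
/-- `rec0_fTim` (auxiliary). [folklore] -/
theorem rec0_fTim (j : ℕ) : rec0 k ev lev s (k + 4 + j) = ThreeCNF.bit j s := by
  simp only [rec0, show k + 4 + j ≠ 0 by omega, show k + 4 + j ≠ 1 by omega,
    show k + 4 + j ≠ 2 by omega, if_false, show ¬ (k + 4 + j ≤ 3 + k) by omega, Nat.add_sub_cancel_left]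

/-- An event is determined by its type and symbol bits. [folklore] -/
theorem ev_eq_of_bits (e : Ev) : e = (match t1E e, t0E e with
    | false, false => Ev.nop
    | false, true => Ev.push (symE e)
    | true, false => Ev.popNone
    | true, true => Ev.popSome (symE e)) := by
  cases e <;> rfl

/-- **The key of a time-`0` record** is `s + 2ᵏ · level`. [folklore] -/
theorem key_rec0 {tb : TabParams} {ev : ℕ → Ev} {lev : ℕ → ℕ} {s : ℕ} (hs : s < tb.S)
    (hl : lev s < 2 ^ (tb.k + 1)) :
    bval (fun i => rec0 tb.k ev lev s (tb.fKey i)) (2 * tb.k + 1) = s + 2 ^ tb.k * lev s := by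
  rw [show 2 * tb.k + 1 = tb.k + (tb.k + 1) by ring, bval_add]
  congr 1
  · rw [bval_congr (g := fun j => ThreeCNF.bit j s) (fun j hj => by
      simp only [TabParams.fKey, hj, if_true, TabParams.fTim]; exact rec0_fTim _ _ _ _ _), bval_bit]
    exact Nat.mod_eq_of_lt hs
  · congr 1
    rw [bval_congr (g := fun j => ThreeCNF.bit j (lev s)) (fun j hj => by
      simp only [TabParams.fKey, show ¬ (tb.k + j < tb.k) by omega, if_false, Nat.add_sub_cancel_left]
      exact rec0_fLev _ _ _ _ (Nat.le_of_lt_succ hj)), bval_bit]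
    exact Nat.mod_eq_of_lt hl

end Rec

/-- The key order as an order of numeric keys. [folklore] -/
theorem key_lt_of_keyLt {k s s' a a' : ℕ} (hs : s < 2 ^ k) (h : a < a' ∨ (a = a' ∧ s < s')) :
    s + 2 ^ k * a < s' + 2 ^ k * a' := by
  rcases h with h | ⟨rfl, h⟩
  · have : 2 ^ k * a + 2 ^ k ≤ 2 ^ k * a' := by rw [← Nat.mul_succ]; exact Nat.mul_le_mul_left _ h
    omega
  · omega

/-- A certificate only reads `π` below `N`. [folklore] -/
theorem cert_congr {ev : ℕ → Ev} {hh : ℕ → ℕ} {N : ℕ} {π π' : ℕ → ℕ} (h : ∀ p < N, π p = π' p)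
    (c : Cert ev hh N π) : Cert ev hh N π' := by
  refine ⟨fun p hp => ?_, fun s hs => ?_, fun p hp => ?_, fun p hp b hev => ?_, fun hN b => ?_⟩
  · rw [← h p hp]; exact c.lt p hp
  · obtain ⟨p, hp, hps⟩ := c.surj s hs; exact ⟨p, hp, by rw [← h p hp, hps]⟩
  · rw [← h p (Nat.lt_of_succ_lt hp), ← h (p + 1) hp]; exact c.sorted p hp
  · rw [← h p (Nat.lt_of_succ_lt hp), ← h (p + 1) hp] at *; exact c.adj p hp b hev
  · rw [← h 0 hN]; exact c.first hN b

/-! ### The intended assignment -/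

section Assignment

variable (tb : TabParams) (x y : List Bool) (swB : Fin tb.K → ℕ → ℕ → Bool)

/-- The levels of the genuine timeline. [folklore] -/
def levG (κ : Fin tb.K) : ℕ → ℕ := level (evG tb x y κ) (ht (evG tb x y κ))

/-- The records of the genuine timeline moved through the networks with settings `swB`.
[folklore] -/
def recB (κ : Fin tb.K) (ℓ p w : ℕ) : Bool :=
  rec0 tb.k (evG tb x y κ) (levG tb x y κ) (back tb.dim (swB κ) ℓ p) w

/-- **The intended assignment** of the tableau for the genuine run on `⟨x, y⟩` with network
settings `swB`. [folklore] -/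
def τG : TabVar tb.K → Bool
  | .x j => x.getD j false
  | .yp j => decide (j < y.length)
  | .yv j => y.getD j false
  | .u s q => decide (tb.I ≤ s ∧ s ≤ tb.Send ∧ (C tb x y s).pc = q)
  | .h κ s j => ThreeCNF.bit j (ht (evG tb x y κ) s)
  | .hc κ s j => hcVal (fun j => ThreeCNF.bit j (ht (evG tb x y κ) s)) (evG tb x y κ s) j
  | .r κ ℓ p w => recB tb x y swB κ ℓ p w
  | .sw κ ℓ q => swB κ ℓ q
  | .lt κ p i => ltVal (fun i => recB tb x y swB κ tb.L p (tb.fKey i))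
      (fun i => recB tb x y swB κ tb.L (p + 1) (tb.fKey i)) i
  | .ae κ p j => aeVal (fun j => recB tb x y swB κ tb.L p (fLev j))
      (fun j => recB tb x y swB κ tb.L (p + 1) (fLev j)) j
  | .aux _ _ => false
  | .dummy => false

/-- The permutation realized by the networks, read backwards. [folklore] -/
def πB (κ : Fin tb.K) (p : ℕ) : ℕ := back tb.dim (swB κ) tb.L p

end Assignment

section Verify

variable {tb : TabParams} {x y : List Bool} {swB : Fin tb.K → ℕ → ℕ → Bool}
variable (hxn : x.length = tb.n) (hy : y.length ≤ tb.Y) {t : ℕ} (ht0 : t ≤ tb.T)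
  (hrun : (tb.P.step^[t]) ⟨0, AStore.single tb.inp (boolPair x y)⟩ = ⟨tb.np, AStore.single tb.out [true]⟩)
  (hcert : ∀ κ, Cert (evG tb x y κ) (ht (evG tb x y κ)) tb.S (πB tb swB κ))

/-- Layer-`0` records are the time-`0` records. [folklore] -/
theorem R_zero (κ : Fin tb.K) (s w : ℕ) :
    R tb (τG tb x y swB) κ 0 s w = rec0 tb.k (evG tb x y κ) (levG tb x y κ) s w := rfl

/-- `ControlStep` says the new address is the `target`. [folklore] -/
theorem controlStep_iff_target {q q' : ℕ} {o : Option Bool} :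
    ControlStep tb.P q o q' ↔ q' = target tb q o := by
  unfold ControlStep target
  rcases tb.P[q]? with _ | ⟨k, a⟩ | ⟨k, j⟩ | ⟨j⟩ <;> exact Iff.rfl

/-- In the machine phase the genuine event is the register event of the genuine step.
[folklore] -/
theorem evG_machine {s : ℕ} (h1 : tb.I ≤ s) (h2 : s < tb.Send) (κ : Fin tb.K) :
    evG tb x y κ s = regEv tb.P κ (C tb x y s).pc (popped tb.P (C tb x y s)) := by
  have hYI : tb.Y ≤ tb.I := Nat.le_add_right _ _
  unfold evG; rw [if_neg (by omega), if_neg (by omega), if_pos h2]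

/-- The popped claim read off the intended records is the genuine popped symbol. [folklore] -/
theorem oClaim_τG {s : ℕ} (h1 : tb.I ≤ s) (h2 : s < tb.Send) :
    oClaim tb (τG tb x y swB) (C tb x y s).pc s = popped tb.P (C tb x y s) := by
  unfold oClaim
  rcases hP : tb.P[(C tb x y s).pc]? with _ | ⟨k, a⟩ | ⟨k, j⟩ | ⟨j⟩
  · simp [popped, hP]
  · simp [popped, hP]
  · simp only []
    rw [R_zero, R_zero, rec0_fT0, rec0_fSym, evG_machine h1 h2]
    simp only [regEv, hP, if_true]
    cases popped tb.P (C tb x y s) <;> rfl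
  · simp [popped, hP]

/-- Output-layer record fields of the intended assignment. [folklore] -/
theorem RL_fT1 (κ : Fin tb.K) (p : ℕ) :
    R tb (τG tb x y swB) κ tb.L p fT1 = t1E (evG tb x y κ (πB tb swB κ p)) :=
  rec0_fT1 tb.k (evG tb x y κ) (levG tb x y κ) (πB tb swB κ p)

/-- `RL_fT0` (auxiliary). [folklore] -/
theorem RL_fT0 (κ : Fin tb.K) (p : ℕ) :
    R tb (τG tb x y swB) κ tb.L p fT0 = t0E (evG tb x y κ (πB tb swB κ p)) :=
  rec0_fT0 tb.k (evG tb x y κ) (levG tb x y κ) (πB tb swB κ p)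

/-- `RL_fSym` (auxiliary). [folklore] -/
theorem RL_fSym (κ : Fin tb.K) (p : ℕ) :
    R tb (τG tb x y swB) κ tb.L p fSym = symE (evG tb x y κ (πB tb swB κ p)) :=
  rec0_fSym tb.k (evG tb x y κ) (levG tb x y κ) (πB tb swB κ p)

/-- `RL_fLev` (auxiliary). [folklore] -/
theorem RL_fLev (κ : Fin tb.K) (p : ℕ) {j : ℕ} (hj : j ≤ tb.k) :
    R tb (τG tb x y swB) κ tb.L p (fLev j) = ThreeCNF.bit j (levG tb x y κ (πB tb swB κ p)) :=
  rec0_fLev tb.k (evG tb x y κ) (levG tb x y κ) (πB tb swB κ p) hj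

/-- An output record with type bits `11` is a `popSome`. [folklore] -/
theorem evG_popSome_of_bits {κ : Fin tb.K} {p : ℕ} (h1 : R tb (τG tb x y swB) κ tb.L p fT1 = true)
    (h0 : R tb (τG tb x y swB) κ tb.L p fT0 = true) :
    evG tb x y κ (πB tb swB κ p) = .popSome (symE (evG tb x y κ (πB tb swB κ p))) := by
  rw [RL_fT1] at h1; rw [RL_fT0] at h0
  have := ev_eq_of_bits (evG tb x y κ (πB tb swB κ p))
  rw [h1, h0] at this; exact this

include hxn hy ht0 hrun in
/-- The heights of the genuine timeline obey the local rules. [folklore] -/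
theorem heightsOK_evG (κ : Fin tb.K) : HeightsOK (evG tb x y κ) (ht (evG tb x y κ)) tb.S :=
  heightsOK_of_consistent (consistent_evG hxn hy ht0 hrun κ)

/-- Levels are small. [folklore] -/
theorem levG_lt {κ : Fin tb.K} {s : ℕ} (hs : s < tb.S) : levG tb x y κ s < 2 ^ (tb.k + 1) := by
  have h1 := ht_le (evG tb x y κ) s
  have h2 := ht_le (evG tb x y κ) (s + 1)
  have hS : tb.S = 2 ^ tb.k := rfl
  unfold levG level
  rw [Nat.pow_succ]
  cases evG tb x y κ s <;> simp <;> omega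

include hcert in
/-- Keys of the output layer increase. [folklore] -/
theorem key_lt_πB (κ : Fin tb.K) {p : ℕ} (hp : p + 1 < tb.S) :
    bval (fun i => recB tb x y swB κ tb.L p (tb.fKey i)) (2 * tb.k + 1) <
      bval (fun i => recB tb x y swB κ tb.L (p + 1) (tb.fKey i)) (2 * tb.k + 1) := by
  have hc := hcert κ
  have hp' : p < tb.S := Nat.lt_of_succ_lt hp
  have h1 : πB tb swB κ p < tb.S := hc.lt p hp'
  have h2 : πB tb swB κ (p + 1) < tb.S := hc.lt (p + 1) hp
  show bval (fun i => rec0 tb.k _ _ (πB tb swB κ p) (tb.fKey i)) _ <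
    bval (fun i => rec0 tb.k _ _ (πB tb swB κ (p + 1)) (tb.fKey i)) _
  rw [key_rec0 h1 (levG_lt h1), key_rec0 h2 (levG_lt h2)]
  exact key_lt_of_keyLt h1 (hc.sorted p hp)

include hxn hy ht0 hrun hcert in
/-- **The intended assignment satisfies the tableau constraints.** [cite: FortnowEtAl2005, §3.1] -/
theorem tabOK_τG : TabOK tb (τG tb x y swB) := by
  have hYI : tb.Y ≤ tb.I := Nat.le_add_right _ _
  have hIS : tb.I ≤ tb.Send := Nat.le_add_right _ _
  have hH : ∀ κ, HeightsOK (evG tb x y κ) (ht (evG tb x y κ)) tb.S :=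
    fun κ => heightsOK_evG hxn hy ht0 hrun κ
  refine {
    recV1 := fun s hs => ?_
    recV2 := fun r hr => ?_
    recNop := fun κ s hs hnop => ?_
    recM := fun κ s h1 h2 q hq hu => ?_
    recF := ?_
    time := fun κ s hs j hj => ?_
    lev := fun κ s hs j hj => ?_
    h0 := fun κ j hj => ?_
    hc0 := fun κ s hs => rfl
    hcK := fun κ s hs h0 => ?_
    hstep := fun κ s hs j hj => ?_
    u0 := ?_
    u2 := fun s h1 h2 q q' hqq hq' hu => ?_
    tr := fun s h1 h2 q hq hu => ?_
    acc := ?_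
    net := fun κ ℓ hℓ p hp w hw => ?_
    lt0 := fun κ p hp => rfl
    ltStep := fun κ p hp i hi => rfl
    ltF := fun κ p hp => ?_
    ae0 := fun κ p hp => rfl
    aeStep := fun κ p hp j hj => rfl
    adj1 := fun κ p hp h1 h0 => ?_
    adj2 := fun κ p hp h1 h0 => ?_
    first := fun κ => ?_ }
  · -- recV1
    have hev : evG tb x y tb.inp s = (if tb.Y - 1 - s < y.length then .push (y.getD (tb.Y - 1 - s) false) else .nop) := by
      unfold evG; rw [if_pos hs]; simp
    rw [R_zero, R_zero, R_zero, rec0_fT1, rec0_fT0, rec0_fSym, hev]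
    show _ ∧ _ = decide (tb.Y - 1 - s < y.length) ∧ _ = y.getD (tb.Y - 1 - s) false
    by_cases hl : tb.Y - 1 - s < y.length
    · simp [hl, t1E, t0E, symE]
    · simp [hl, t1E, t0E, symE]
  · -- recV2
    have hev := (virtualPhase_evG (tb := tb) (x := x) (y := y)).v2 r hr
    rw [R_zero, R_zero, R_zero, rec0_fT1, rec0_fT0, rec0_fSym, hev]
    refine ⟨rfl, rfl, ?_⟩
    cases v2src tb.n r <;> rfl
  · -- recNop
    have hev : evG tb x y κ s = .nop := by
      rcases hnop with ⟨h1, hκ⟩ | ⟨rfl, hκ⟩ | h1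
      · exact (virtualPhase_evG (tb := tb) (x := x) (y := y)).other κ hκ s h1
      · unfold evG; rw [if_neg (by omega), if_neg (by omega), if_neg (lt_irrefl _), if_pos rfl, if_neg hκ]
      · unfold evG; rw [if_neg (by omega), if_neg (by omega), if_neg (by omega), if_neg (by omega)]
    rw [R_zero, R_zero, rec0_fT1, rec0_fT0, hev]; exact ⟨rfl, rfl⟩
  · -- recM
    have hpc : (C tb x y s).pc = q := by simpa [τG, h1, h2.le] using hu
    have hev := evG_machine (x := x) (y := y) h1 h2 κ
    rw [hpc] at hev
    unfold MSpec
    simp only [R_zero, rec0_fT1, rec0_fT0, rec0_fSym, hev, regEv]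
    rcases hP : tb.P[q]? with _ | ⟨k', a⟩ | ⟨k', j⟩ | ⟨j⟩ <;> simp only []
    · exact ⟨rfl, rfl⟩
    · by_cases hk : k' = κ
      · subst hk; simp [t1E, t0E, symE]
      · simp [hk, t1E, t0E]
    · by_cases hk : k' = κ
      · subst hk; simp only [if_true]; cases popped tb.P (C tb x y s) <;> rfl
      · simp [hk, t1E, t0E]
    · exact ⟨rfl, rfl⟩
  · -- recF
    have hev : evG tb x y tb.out tb.Send = .popSome true := by
      unfold evG; rw [if_neg (by omega), if_neg (by omega), if_neg (lt_irrefl _), if_pos rfl, if_pos rfl]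
    rw [R_zero, R_zero, R_zero, rec0_fT1, rec0_fT0, rec0_fSym, hev]; exact ⟨rfl, rfl, rfl⟩
  · -- time
    rw [R_zero]; exact rec0_fTim _ _ _ _ _
  · -- lev
    simp only [R_zero, rec0_fT1, rec0_fT0, rec0_fLev _ _ _ _ hj, τG, levG, level]
    cases hev : evG tb x y κ s <;> simp [t1E, t0E, bit_zero]
  · -- h0
    show ThreeCNF.bit j (ht (evG tb x y κ) 0) = false
    rw [show ht (evG tb x y κ) 0 = 0 from rfl]; exact bit_zero j
  · -- hcK
    rw [R_zero, rec0_fT0] at h0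
    have hrule := (hH κ).2 s hs
    have hle := ht_le (evG tb x y κ) s
    have hS : tb.S = 2 ^ tb.k := rfl
    show hcVal (fun j => ThreeCNF.bit j (ht (evG tb x y κ) s)) (evG tb x y κ s) (tb.k + 1) = false
    revert h0 hrule
    cases hev : evG tb x y κ s with
    | nop => intro h0; exact absurd h0 (by simp [t0E])
    | popNone => intro h0; exact absurd h0 (by simp [t0E])
    | push b =>
      intro _ hrule
      exact (inc_bits (m := tb.k + 1) (by rw [Nat.pow_succ]; omega) b).2
    | popSome b =>
      intro _ hrule
      exact (dec_bits (m := tb.k + 1) (by rw [Nat.pow_succ]; omega) (by omega) b).2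
  · -- hstep
    have hrule := (hH κ).2 s hs
    have hle := ht_le (evG tb x y κ) s
    have hS : tb.S = 2 ^ tb.k := rfl
    simp only [R_zero, rec0_fT1, rec0_fT0]
    show HStepRel (t1E (evG tb x y κ s)) (t0E (evG tb x y κ s)) (ThreeCNF.bit j (ht (evG tb x y κ) s))
      (hcVal (fun j => ThreeCNF.bit j (ht (evG tb x y κ) s)) (evG tb x y κ s) j)
      (ThreeCNF.bit j (ht (evG tb x y κ) (s + 1)))
      (hcVal (fun j => ThreeCNF.bit j (ht (evG tb x y κ) s)) (evG tb x y κ s) (j + 1))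
    revert hrule
    cases hev : evG tb x y κ s with
    | nop => intro hrule; simp only [HStepRel, t1E, t0E]; rw [hrule]
    | popNone => intro hrule; simp only [HStepRel, t1E, t0E]; rw [hrule.1, hrule.2]; exact ⟨bit_zero j, bit_zero j⟩
    | push b =>
      intro hrule
      simp only [HStepRel, t1E, t0E]
      rw [hrule]
      exact ⟨(inc_bits (m := tb.k + 1) (by rw [Nat.pow_succ]; omega) b).1 j (Nat.lt_succ_of_le hj), rfl⟩
    | popSome b =>
      intro hrule
      simp only [HStepRel, t1E, t0E]
      rw [show ht (evG tb x y κ) (s + 1) = ht (evG tb x y κ) s - 1 by omega]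
      exact ⟨(dec_bits (m := tb.k + 1) (by rw [Nat.pow_succ]; omega) (by omega) b).1 j (Nat.lt_succ_of_le hj), rfl⟩
  · -- u0
    show decide _ = true
    simp only [decide_eq_true_eq]
    exact ⟨le_rfl, hIS, by rw [C_I]⟩
  · -- u2
    simp only [τG, decide_eq_true_eq] at hu
    omega
  · -- tr
    have hpc : (C tb x y s).pc = q := by simpa [τG, h1, h2.le] using hu
    subst hpc
    rw [oClaim_τG h1 h2]
    have hcs := (transcript_of_step tb.P (C tb x y s)).1
    rw [controlStep_iff_target] at hcs
    rw [← hcs, ← C_succ h1]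
    refine ⟨pc_C_le ht0 hrun (Nat.le_succ_of_le h1) (Nat.succ_le_of_lt h2), ?_⟩
    show decide _ = true
    simp only [decide_eq_true_eq]
    exact ⟨Nat.le_succ_of_le h1, Nat.succ_le_of_lt h2, by trivial⟩
  · -- acc
    show decide _ = true
    simp only [decide_eq_true_eq]
    exact ⟨hIS, le_rfl, by rw [C_Send ht0 hrun]⟩
  · -- net
    show rec0 tb.k _ _ (back tb.dim (swB κ) ℓ (layer (tb.dim ℓ) (swB κ ℓ) p)) w = _
    unfold layer
    simp only [R, τG, recB]
    split_ifs <;> rfl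
  · -- ltF
    simp only [τG]
    exact (lt_chain (l := ltVal (fun i => recB tb x y swB κ tb.L p (tb.fKey i))
      (fun i => recB tb x y swB κ tb.L (p + 1) (tb.fKey i))) rfl (2 * tb.k + 1)
      (fun i _ => rfl)).2 (key_lt_πB hcert κ hp)
  · -- adj1
    have hc := hcert κ
    obtain ⟨hpush, hlev⟩ := hc.adj p hp _ (evG_popSome_of_bits h1 h0)
    refine ⟨?_, ?_, ?_⟩
    · rw [RL_fT1, hpush]; rfl
    · rw [RL_fT0, hpush]; rfl
    · show aeVal _ _ (tb.k + 1) = true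
      refine aeVal_of_eq fun j hj => ?_
      show R tb (τG tb x y swB) κ tb.L p (fLev j) = R tb (τG tb x y swB) κ tb.L (p + 1) (fLev j)
      rw [RL_fLev κ p (Nat.le_of_lt_succ hj), RL_fLev κ (p + 1) (Nat.le_of_lt_succ hj)]
      unfold levG; rw [hlev]
  · -- adj2
    have hc := hcert κ
    obtain ⟨hpush, -⟩ := hc.adj p hp _ (evG_popSome_of_bits h1 h0)
    rw [RL_fSym, RL_fSym, hpush]; rfl
  · -- first
    have hc := hcert κ
    rintro ⟨h1, h0⟩
    exact hc.first (Nat.two_pow_pos _) _ (evG_popSome_of_bits h1 h0)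

end Verify

/-! ### Completeness -/

section Main

variable {tb : TabParams} {x y : List Bool}

/-- **Completeness of the tableau constraints.** If the program, started at address `0` with
`boolPair x y` on `inp` (`|x| = n`, `|y| ≤ Y`), is at the halting address with `out = [true]`
after `t ≤ T` steps, then some assignment satisfies `TabOK` and spells `x` on the input-copy
variables. [cite: FortnowEtAl2005, §3.1] -/
theorem tabOK_complete (hxn : x.length = tb.n) (hy : y.length ≤ tb.Y) {t : ℕ} (ht0 : t ≤ tb.T)
    (hrun : (tb.P.step^[t]) ⟨0, AStore.single tb.inp (boolPair x y)⟩ = ⟨tb.np, AStore.single tb.out [true]⟩) :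
    ∃ τ : TabVar tb.K → Bool, TabOK tb τ ∧ ∀ j < tb.n, τ (.x j) = x.getD j false := by
  classical
  have hsw : ∀ κ : Fin tb.K, ∃ s : ℕ → ℕ → Bool,
      Cert (evG tb x y κ) (ht (evG tb x y κ)) tb.S (fun p => back tb.dim s tb.L p) := by
    intro κ
    obtain ⟨-, π, hc⟩ := exists_cert_of_consistent (consistent_evG hxn hy ht0 hrun κ)
    -- an inverse of `π` on `[0, S)`
    let g : ℕ → ℕ := fun q => if hq : q < tb.S then Classical.choose (hc.surj q hq) else 0
    have hg : ∀ q < tb.S, g q < tb.S ∧ π (g q) = q := fun q hq => by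
      simp only [g, dif_pos hq]; exact (Classical.choose_spec (hc.surj q hq)).imp_right id |>.imp id id
    have hf : ∀ p < tb.S, π p < tb.S ∧ g (π p) = p := fun p hp => by
      refine ⟨hc.lt p hp, ?_⟩
      obtain ⟨h1, h2⟩ := hg (π p) (hc.lt p hp)
      exact hc.injOn h1 hp h2
    obtain ⟨sw, hsw⟩ := exists_switches tb.k π g hf hg
    refine ⟨fun ℓ => sw (tb.L - 1 - ℓ), cert_congr (fun p hp => ?_) hc⟩
    rw [back_L, ← hsw p hp]
    refine run_congr (fun i hi => ?_) p
    rw [length_dims] at hi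
    congr 1; unfold TabParams.L; omega
  choose swB hswB using hsw
  exact ⟨τG tb x y swB, tabOK_τG hxn hy ht0 hrun hswB, fun j _ => rfl⟩

end Main



end Tableau

end Literature.Computability.Complexity
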